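import Mathlib
import HarnessLib
import Literature.MathematicalPhysics.StatisticalMechanics.AbkmPackageSlots
import Literature.MathematicalPhysics.StatisticalMechanics.AbkmPackageShrink
import Literature.MathematicalPhysics.StatisticalMechanics.AbkmTwoKernelHolderPair
import Literature.MathematicalPhysics.StatisticalMechanics.NextHamiltonianKernelSubTorusFRD
import Literature.MathematicalPhysics.StatisticalMechanics.StepOperatorBKernelSubScale
import Literature.MathematicalPhysics.StatisticalMechanics.FluctuationKernelComparisonConnTorusFRD
import Literature.MathematicalPhysics.StatisticalMechanics.StepOperatorBLipschitzUnifTorusFRD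
import Literature.MathematicalPhysics.StatisticalMechanics.TorusFRDStepKernelPair

/-!
# [ABKM19] Lemma 12.6: the EXTRACTED HAMILTONIAN `H̃ = A_kH + B_kK` is Lipschitz in the tuning parameter,
# `N`-FREE, for EVERY package: `‖H̃^{(q')} − H̃^{(q)}‖_{k,0} ≤ ℓ_H(P) · |q' − q|₁ · max(‖u‖, ‖v‖_k)`

The two-kernel twins of the Theorem-6.8 remainder files (stub 1 of the line `banach_two_kernel` of the child
`TwoKernelSkBound` of the cruxes `HypACumulant` / `HypALocalTwoPoint`) compare the remainder sums `Σ₁, Σ₂ᴸ, Σ₃, Σ₄`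
at two step kernels; half of each twin is the EXISTING free-`H̃` Lipschitz bound of the remainder
(`tayNormLE_remainder…_sub_abkm_of_stepKernelBounds` with `(H', K') = (H, K)`, `(H̃, H̃') = (H̃^{(q)}, H̃^{(q')})`),
whose input is the size of `H̃^{(q')} − H̃^{(q)}`.  This file provides that size with an `N`-FREE constant for every
package: `NextHamiltonianKernelSubTorusFRD.hamNorm_nextH_sub_of_torusFRD` (the `A_k`-part, kernel regularity) plus
`StepOperatorBKernelSubScale.hamNorm_opB_sub_abkm_le_scale_of_stepKernelBounds` (the `B_k`-part) fed with the
per-CONNECTED-polymer pair property `tayNormLE_fluct_sub_fluct_conn_of_torusFRD` (volume-uniform; polynomial factor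
absorbed into `κ' = 2^d A_𝒫(ρ'')^{1/p}`, Hölder pair of `AbkmTwoKernelHolderPair`), and `|q' − q|₁ ≤ 1` on the ball:

* **`PackageData.exists_hamNorm_nextH_sub`** — `∀ P, ∃ ℓ_H ≥ 0, ∀ N M Q, ∀ q q' ∈ ball, ∀ k + 1 ≤ N, ∀ u v c_v`,
  `‖v‖_k ≤ c_v`: `‖nextH D_{q'} (toHam u) (mulExt v) − nextH D_q (toHam u) (mulExt v)‖_{k,0} ≤ ℓ_H·|q'−q|₁·max(‖u‖, c_v)`.

Everything is proved; no named fact.  Use (honest scope): rung route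
`Summits/HubbardSuperconductivity/…/Theses/ComplexGFFStiffness`; nothing about superconductivity in the Hubbard model.

## References
* S. Adams, S. Buchholz, R. Kotecký, S. Müller, arXiv:1910.13564 — Lemma 12.6 (12.51)–(12.52), Lemma 10.6, Lemma 8.4
  [AdamsBuchholzKoteckyMuller2019].
* S. Buchholz, J. Funct. Anal. 275 (2018), Thm 4.5 [Buchholz2016].
-/

noncomputable section

namespace Literature.MathematicalPhysics.StatisticalMechanics.GradientRG

open scoped BigOperators Classical
open Finset
open Literature.MathematicalPhysics.StatisticalMechanics.TorusPolymer (IsPolymer numBlocks blockOf)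
open Literature.Barriers.CriticalPhenomena.LongRangePhi4.Polymer (IsConn)

variable {d : ℕ}

namespace PackageData

set_option maxHeartbeats 800000 in
/-- **`H̃^{(q)}` is Lipschitz in `q` with an `N`-free constant, every package** (module docstring).
[cite: AdamsBuchholzKoteckyMuller2019, Lemma 12.6 (12.51)–(12.52)] -/
theorem exists_hamNorm_nextH_sub (P : PackageData d) [Fact (0 < P.h)] [Fact (0 < P.L)] :
    ∃ ℓH : ℝ, 0 ≤ ℓH ∧ ∀ (N M : ℕ) [NeZero M] (Q : PackageAt P N M) (q q' : Matrix (Fin d) (Fin d) ℝ),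
      P.InBall q → P.InBall q' → ∀ k, k + 1 ≤ N →
      ∀ (u : HamSpace ℂ d (fieldWt P.h (P.L : ℝ) d k) ((P.L : ℝ) ^ k) (P.L ^ (d * k)))
        (v : activitySpace Q.normParams k) (cv : ℝ), activityNormLE Q.normParams k v cv →
        hamNorm (fieldWt P.h (P.L : ℝ) d k) ((P.L : ℝ) ^ k) (P.L ^ (d * k))
          (nextH (abkmStepData P.L P.R k (Q.kernels q')) (HamSpace.toHam u)
              (mulExt ((v : activitySpace Q.normParams k) :
                Finset (Fin d → ZMod M) → ((Fin d → ZMod M) → ℝ) → ℂ)) -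
            nextH (abkmStepData P.L P.R k (Q.kernels q)) (HamSpace.toHam u)
              (mulExt ((v : activitySpace Q.normParams k) :
                Finset (Fin d → ZMod M) → ((Fin d → ZMod M) → ℝ) → ℂ))) ≤
          ℓH * esum (q' - q) * max ‖u‖ cv := by
  -- the Hölder pair and the per-block constant `κ' = 2^d A_𝒫(ρ'')^{1/p}`
  set c₁ := traceConst d P.Mord P.R P.lam (derivSum d P.n fun θ' _ => P.Cα θ' 0) with hc₁
  have hc₁0 : 0 ≤ c₁ := traceConst_nonneg d P.Mord P.R P.hlam.le (derivSum_nonneg d P.n _)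
  obtain ⟨p, qH, ρ'', hpq, hρ''0, hρ''bar, -, hpρ, -⟩ :=
    exists_holderPair_weightIntConstRho_le_two_mul (c₁ := c₁) P.hθbar P.hθ0 P.hθ hc₁0
  set κ := weightIntConstRho P.θbar ρ'' c₁ ^ (1 / p) with hκdef
  have hW0 : 0 ≤ weightIntConstRho P.θbar ρ'' c₁ :=
    zero_le_one.trans (one_le_weightIntConstRho P.hθbar hρ''0 hρ''bar hc₁0)
  have hκ0 : 0 ≤ κ := Real.rpow_nonneg hW0 _
  set κ' := (2 : ℝ) ^ d * κ with hκ'def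
  have hκ'0 : 0 ≤ κ' := by positivity
  -- the `N`-free constant
  have hL0 : (0 : ℝ) < P.L := by exact_mod_cast P.hLodd.pos
  have hA0 : 0 < P.A := P.A_pos
  set Ksh := shellRatioConst P.c (P.Cℓ 1) (P.L : ℝ) d P.ñ with hKsh
  have hKsh0 : 0 ≤ Ksh := shellRatioConst_nonneg P.hc P.hC1 hL0.le d P.ñ
  set c₂ : ℕ := 2 * (2 ^ d + P.R) + 2 * P.pT + 1 with hc₂
  set sq := Real.sqrt ((3 : ℝ) ^ (d + 1) * (((2 * (c₂ + 1) : ℕ) : ℝ)) ^ d) with hsq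
  have hsq0 : 0 ≤ sq := Real.sqrt_nonneg _
  have hqH0 : 0 ≤ qH := le_of_lt (lt_trans one_pos hpq.symm.lt)
  set ℓ₁ := ((P.r₀ : ℝ) + 1) * (8 * qH * (sq * (Real.exp (2 * Ksh) * Ksh))) with hℓ₁
  have hℓ₁0 : 0 ≤ ℓ₁ := by positivity
  set C'' := secondDiffConst (fun α => P.Cα α 1) with hC''
  have hC''0 : 0 ≤ C'' := secondDiffConst_nonneg _
  set C87 := pi2BoundConst d (((2 * P.R + 2 : ℕ) : ℝ) + ((d / 2 + 1 : ℕ) : ℝ)) with hC87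
  have hC870 : 0 ≤ C87 := pi2BoundConst_nonneg d (by positivity)
  have hh0 : 0 < P.h := P.hh
  set ℓH := C'' / P.h ^ 2 + C87 * (ℓ₁ * κ' * P.A⁻¹) with hℓH
  have hℓH0 : 0 ≤ ℓH := by
    have : 0 ≤ P.A⁻¹ := inv_nonneg.2 hA0.le
    positivity
  refine ⟨ℓH, hℓH0, ?_⟩
  intro N M _ Q q q' hq hq' k hk u v cv hv
  -- the data
  have hPA : 0 < Q.normParams.A := P.A_pos
  have hMt : M = Q.normParams.L ^ k * P.L ^ (N - k) := by
    show M = P.L ^ k * P.L ^ (N - k)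
    rw [Q.hM, ← pow_add, Nat.add_sub_cancel' (by omega)]
  have hcv0 : 0 ≤ cv := nonneg_of_weakNormLE hPA hMt P.hLodd.pow P.hLodd.pow hv
  set H := HamSpace.toHam u with hHdef
  set Kf := mulExt ((v : activitySpace Q.normParams k) : Finset (Fin d → ZMod M) → ((Fin d → ZMod M) → ℝ) → ℂ)
    with hKfdef
  have hKw : WeakNormLE Q.normParams k Kf cv := activitySpace.weakNormLE_mulExt v hv
  have hKd : ∀ Y, ContDiff ℝ P.r₀ (Kf Y) := activitySpace.contDiff_mulExt v
  have hKloc : ∀ Y, IsPolymer (P.L ^ k) Y → IsConn Y → IsGaugeLocal (Q.normParams.gauge k Y) (Kf Y) :=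
    fun Y hY hYc => activitySpace.isGaugeLocal_mulExt v hY hYc
  have hq2 : ∑ i, ∑ j, |q i j| ≤ 1 / 2 := hq.2.trans P.hT₀
  have hq'2 : ∑ i, ∑ j, |q' i j| ≤ 1 / 2 := hq'.2.trans P.hT₀
  have hnormu : hamNorm (fieldWt P.h (P.L : ℝ) d k) ((P.L : ℝ) ^ k) (P.L ^ (d * k)) H = ‖u‖ := by
    rw [hHdef, HamSpace.norm_def]
  -- `|q' − q|₁ ≤ 1`
  set t := esum (q' - q) with htdef
  have ht0 : 0 ≤ t := entrySum_nonneg _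
  have ht1 : t ≤ 1 := by
    have h1 : esum (q' - q) ≤ esum q' + esum q := by
      unfold esum
      rw [← Finset.sum_add_distrib]
      refine Finset.sum_le_sum fun i _ => ?_
      rw [← Finset.sum_add_distrib]
      refine Finset.sum_le_sum fun j _ => ?_
      rw [Matrix.sub_apply]
      exact abs_sub _ _
    have h2 : esum q' ≤ P.T₀ := hq'.2
    have h3 : esum q ≤ P.T₀ := hq.2
    linarith [P.hT₀]
  set EK := t * Real.exp (2 * Ksh * t) * Ksh with hEK
  have hEK0 : 0 ≤ EK := by positivity
  have hEK1 : EK ≤ t * (Real.exp (2 * Ksh) * Ksh) := by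
    have hexp : Real.exp (2 * Ksh * t) ≤ Real.exp (2 * Ksh) := by
      apply Real.exp_le_exp.2
      nlinarith
    rw [hEK, mul_assoc]
    exact mul_le_mul_of_nonneg_left (mul_le_mul_of_nonneg_right hexp hKsh0) ht0
  set ℓt := ((P.r₀ : ℝ) + 1) * (8 * qH * (sq * EK)) with hℓtdef
  have hℓt0 : 0 ≤ ℓt := by positivity
  have hℓt : ℓt ≤ ℓ₁ * t := by
    rw [hℓtdef, hℓ₁]
    have h1 := mul_le_mul_of_nonneg_left hEK1 hsq0
    have h2 := mul_le_mul_of_nonneg_left h1 (by positivity : (0 : ℝ) ≤ 8 * qH)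
    have h3 := mul_le_mul_of_nonneg_left h2 (by positivity : (0 : ℝ) ≤ (P.r₀ : ℝ) + 1)
    calc ((P.r₀ : ℝ) + 1) * (8 * qH * (sq * EK))
        ≤ ((P.r₀ : ℝ) + 1) * (8 * qH * (sq * (t * (Real.exp (2 * Ksh) * Ksh)))) := h3
      _ = ((P.r₀ : ℝ) + 1) * (8 * qH * (sq * (Real.exp (2 * Ksh) * Ksh))) * t := by ring
  -- the step data and their kernel bounds
  set Da := abkmStepData P.L P.R k (Q.kernels q') with hDa
  set Db := abkmStepData P.L P.R k (Q.kernels q) with hDb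
  have hSa := stepKernelBounds_family_of_torusFRD P.hd P.hMord P.hMR P.hLodd P.hL P.hθbar P.hlam P.hn P.hn2
    P.hnñ P.hc P.hC1 Q.hallA Q.hB P.hθ0 P.hθ P.hT₀ P.hKT₀ hq'.1 hq'.2 k hk
  have hSb := stepKernelBounds_family_of_torusFRD P.hd P.hMord P.hMR P.hLodd P.hL P.hθbar P.hlam P.hn P.hn2
    P.hnñ P.hc P.hC1 Q.hallA Q.hB P.hθ0 P.hθ P.hT₀ P.hKT₀ hq.1 hq.2 k hk
  -- the pair property on connected polymers, polynomial factor absorbed into `κ' = 2^d κ`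
  have hdiff : ∀ X : Finset (Fin d → ZMod M), IsPolymer (P.L ^ k) X → IsConn X →
      ∀ (F : ((Fin d → ZMod M) → ℝ) → ℂ) (C0 : ℝ), 0 ≤ C0 → ContDiff ℝ P.r₀ F →
        IsGaugeLocal (Q.normParams.gauge k X) F →
        TayNormLE (Q.normParams.gauge k X) P.r₀
          ((abkmWeightData P.L N P.Mord P.R P.θbar (schedDelta P.δ₀ P.δ₁ N) fun j => Q.𝒞 1 j).weight k X) F C0 →
          TayNormLE (Q.normParams.gauge k X) P.r₀
            ((abkmWeightData P.L N P.Mord P.R P.θbar (schedDelta P.δ₀ P.δ₁ N) fun j => Q.𝒞 1 j).midWeight k X)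
            (fluct Da.𝒞 F - fluct Db.𝒞 F) (C0 * ℓt * κ' ^ numBlocks (P.L ^ k) X) := by
    intro X hX hXc F C0 hC0 hFd hFloc hF
    have hconn := tayNormLE_fluct_sub_fluct_conn_of_torusFRD P.hd P.hMord P.hMR P.hLodd P.hL Q.hM P.hθbar P.hlam
      P.hn P.hn2 P.hnñ P.hgap P.hc P.hC1 Q.hallA Q.hB hk P.hθ0 P.hθ P.hT₀ P.hKT₀ hq.1 hq'.1 hq.2 hq'.2 hpq hρ''0
      hρ''bar hpρ hX hXc hC0 hFd hFloc hF (pT := P.pT) (r₀ := P.r₀) (h := P.h) (A := P.A)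
    refine hconn.mono ?_ (fun φ =>
      ((abkmWeightData P.L N P.Mord P.R P.θbar (schedDelta P.δ₀ P.δ₁ N) fun j => Q.𝒞 1 j).midWeight_pos k X φ).le)
    set m := numBlocks (P.L ^ k) X with hm
    have hsq' := sqrt_polymerFactor_le d m c₂
    have hmc : 2 * (m + 2 * (2 ^ d + P.R) + 2 * P.pT + 1) = 2 * (m + c₂) := by rw [hc₂]; ring
    rw [hmc]
    calc C0 * ((P.r₀ + 1) * (8 * qH * (Real.sqrt ((3 : ℝ) ^ (d + 1) * (((2 * (m + c₂) : ℕ) : ℝ)) ^ d) * EK))) * κ ^ m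
        ≤ C0 * ((P.r₀ + 1) * (8 * qH *
            (Real.sqrt ((3 : ℝ) ^ (d + 1) * (((2 * (c₂ + 1) : ℕ) : ℝ)) ^ d) * ((2 : ℝ) ^ d) ^ m * EK))) * κ ^ m := by
          have : Real.sqrt ((3 : ℝ) ^ (d + 1) * (((2 * (m + c₂) : ℕ) : ℝ)) ^ d) * EK ≤
              Real.sqrt ((3 : ℝ) ^ (d + 1) * (((2 * (c₂ + 1) : ℕ) : ℝ)) ^ d) * ((2 : ℝ) ^ d) ^ m * EK :=
            mul_le_mul_of_nonneg_right hsq' hEK0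
          gcongr
      _ = C0 * ((P.r₀ + 1) * (8 * qH * (Real.sqrt ((3 : ℝ) ^ (d + 1) * (((2 * (c₂ + 1) : ℕ) : ℝ)) ^ d) * EK))) *
            ((2 : ℝ) ^ d * κ) ^ m := by
          rw [mul_pow]; ring
  -- the two inputs
  have hpR : P.pT ≤ P.R := by have := P.hpM; have := P.hMR; omega
  have hp1 : d / 2 + 1 ≤ P.pT := by have := P.hp; omega
  have hnextH := hamNorm_nextH_sub_of_torusFRD P.hd P.hLodd P.hL Q.hM P.hn2 P.hc Q.hallA hk hpR hp1 P.hh hq.1 hq'.1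
    hq2 hq'2 H Kf
  have hopB := hamNorm_opB_sub_abkm_le_scale_of_stepKernelBounds (p := P.pT) P.hd P.hLodd P.hL Q.hM hk P.hpM P.hMR
    P.hr₀ Q.hB P.hh P.hA1 Da Db hSa hSb (x₀ := 0) rfl rfl rfl rfl hdiff hcv0 hKw hKd hKloc
  -- assembly
  set m := max ‖u‖ cv with hmax
  have hum : ‖u‖ ≤ m := le_max_left _ _
  have hcm : cv ≤ m := le_max_right _ _
  have hm0 : 0 ≤ m := le_max_of_le_left (norm_nonneg _)
  have hAinv : 0 ≤ P.A⁻¹ := inv_nonneg.2 hA0.le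
  have e1 : C'' * t / P.h ^ 2 * ‖u‖ ≤ C'' / P.h ^ 2 * t * m := by
    rw [show C'' * t / P.h ^ 2 * ‖u‖ = C'' / P.h ^ 2 * t * ‖u‖ by ring]
    exact mul_le_mul_of_nonneg_left hum (by positivity)
  have e2 : C87 * (cv * ℓt * κ' * P.A⁻¹) ≤ C87 * (m * (ℓ₁ * t) * κ' * P.A⁻¹) := by
    apply mul_le_mul_of_nonneg_left _ hC870
    have := mul_le_mul hcm hℓt hℓt0 (hcv0.trans hcm)
    exact mul_le_mul_of_nonneg_right (mul_le_mul_of_nonneg_right this hκ'0) hAinv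
  calc hamNorm (fieldWt P.h (P.L : ℝ) d k) ((P.L : ℝ) ^ k) (P.L ^ (d * k)) (nextH Da H Kf - nextH Db H Kf)
      ≤ C'' * t / P.h ^ 2 * hamNorm (fieldWt P.h (P.L : ℝ) d k) ((P.L : ℝ) ^ k) (P.L ^ (d * k)) H +
          hamNorm (fieldWt P.h (P.L : ℝ) d k) ((P.L : ℝ) ^ k) (P.L ^ (d * k)) (opB Da Kf - opB Db Kf) := hnextH
    _ ≤ C'' * t / P.h ^ 2 * ‖u‖ + C87 * (cv * ℓt * κ' * P.A⁻¹) := by rw [hnormu]; exact add_le_add le_rfl hopB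
    _ ≤ C'' / P.h ^ 2 * t * m + C87 * (m * (ℓ₁ * t) * κ' * P.A⁻¹) := add_le_add e1 e2
    _ = ℓH * t * m := by rw [hℓH]; ring

end PackageData

end Literature.MathematicalPhysics.StatisticalMechanics.GradientRG

end
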